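/-
COR-CM (cell pub-hodgecm2, stage 2 of the Hodge ladder) — count-neutral kernel combinatorics (seat prover-pub-hodgecm2-b23-g40-0, binder
prover b23, gen 40; claim COMPLEMENT-FACES F7, HOME/INBOX.md l.9766/l.9839; companion of `Census/ComplementFacesGenerate.lean`).  Theorems
only, in seat b09's intrinsic model (`CMF G c`, `Block`, `cplT`, and b09's Burnside count `BlockParity.card_block_mul_card` — consumed BY NAME,
nothing restated); no definition, no certificate, no `decide`, no named fact, no geometry, no `sorry`.  `Interfaces.lean` (C1), every E term,
B01 and `Transposition/*` are untouched.
HONEST FRAMING: `HC_CM` is NOT proved, here or anywhere in the tree; nothing here is a period or a headline.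
-/
import Summits.HodgeConjecture.CorCM.Census.ComplementFacesWeight

/-!
# Faces of a complemented Galois CM type, VI: the number of blocks from the order statistics of the complement

For `G` finite, `c` a CENTRAL involution `≠ 1` and a COMPLEMENT `A` (`x ∈ A ↔ c·x ∉ A`, `G = A × ⟨c⟩`, `n = |A| = |G|/2`, `A` any finite
group), seat b09's Burnside count `β(G, c)·|G| = Σ_{g ∈ G} [c ∉ ⟨g⟩]·2^{|G|/ord g/2}` (`BlockParity.card_block_mul_card`) becomes a sum over
the complement alone (**`card_block_mul_card_of_cpl`**):

  `β(G, c) · |G| = Σ_{a ∈ A} (1 + [ord a even]) · 2^{n / ord a}`,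

because for `a ∈ A`: `c ∉ ⟨a⟩ ⊆ A`; `c·a` has `c ∈ ⟨c·a⟩` iff `ord a` is odd (`mem_zpowers_cmul_iff`), and `ord (c·a) = ord a` when `ord a`
is even (`orderOf_cmul_of_even`).  With part V (`μ = β − 1 − δ`) this gives the minimal face numbers of the complemented Galois CM types from the
order statistics of `A ≅ Gal(F⁺/ℚ)`: e.g. `A = S₃` (`1·64 + 3·2·8 + 2·4 = 120 = 10·12`, `β = 10`, `μ = 8`), `D₄` (`β = 27`, `μ = 25`), `Q₈`
(`β = 21`, `μ = 19`) — numerals not decided here.  For `|A|` odd no element has even order and `β·|G| = Σ_{a ∈ A} 2^{n / ord a}`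
(`card_block_mul_card_of_cpl_odd`), i.e. `β` is half the number of `A`-orbits of subsets of `A`.
All [folklore] bookkeeping over [Milne1999, Prop. 2.1] (blocks ↔ simple CM isogeny classes split by `F`).

## References
* [Milne1999] J. S. Milne, Lefschetz motives and the Tate conjecture, Compositio Math. 117 (1999), Prop. 2.1, p. 54.
* [Pohlmann1968] H. Pohlmann, Algebraic cycles on abelian varieties of complex multiplication type, Ann. of Math. 88 (1968), Thm 1.
-/

namespace Summit.HodgeConjecture.CorCM.Census.ComplementFaces

open Finset
open Summit.HodgeConjecture.CorCM.Prior.AllgGroup.RfwfAllgGroup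
open Summit.HodgeConjecture.CorCM.Census.BlockParity
open Summit.HodgeConjecture.CorCM.Census.Coinvariant

noncomputable section

variable {G : Type*} [Group G] [Fintype G] [DecidableEq G] (c : G)
variable {A : Subgroup G} (hA : ∀ x : G, x ∈ A ↔ c * x ∉ A)

/-! ## §1 Powers of `c·a` for `a` in the complement -/

omit [Fintype G] [DecidableEq G] in
/-- Powers of an involution: `c^k = 1` for `k` even. [folklore] -/
theorem pow_eq_one_of_even (hc2 : c * c = 1) {k : ℕ} (hk : Even k) : c ^ k = 1 := by
  obtain ⟨j, rfl⟩ := hk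
  rw [← two_mul, pow_mul, pow_two, hc2, one_pow]

omit [Fintype G] [DecidableEq G] in
/-- Powers of an involution: `c^k = c` for `k` odd. [folklore] -/
theorem pow_eq_self_of_odd (hc2 : c * c = 1) {k : ℕ} (hk : Odd k) : c ^ k = c := by
  obtain ⟨j, rfl⟩ := hk
  rw [pow_succ, pow_eq_one_of_even c hc2 (even_two_mul j), one_mul]

include hA in
omit [Fintype G] [DecidableEq G] in
/-- `c` is not a power of an element of the complement. [folklore] -/
theorem not_mem_zpowers_of_mem (hc2 : c * c = 1) {a : G} (ha : a ∈ A) : c ∉ Subgroup.zpowers a :=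
  fun h => self_notMem_cpl c hc2 hA (Subgroup.zpowers_le.mpr ha h)

include hA in
omit [DecidableEq G] in
/-- **`c ∈ ⟨c·a⟩ ↔ ord a` is odd** (`a` in the complement, `c` central). [folklore] -/
theorem mem_zpowers_cmul_iff (hc2 : c * c = 1) (hcen : ∀ x : G, x * c = c * x) {a : G} (ha : a ∈ A) :
    c ∈ Subgroup.zpowers (c * a) ↔ Odd (orderOf a) := by
  have hcomm : Commute c a := (hcen a).symm
  constructor
  · intro h
    obtain ⟨k, hk⟩ := (Submonoid.mem_powers_iff _ _).mp (mem_powers_iff_mem_zpowers.mpr h)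
    rw [hcomm.mul_pow] at hk
    rcases Nat.even_or_odd k with he | ho
    · -- `c = a^k ∈ A`: impossible
      rw [pow_eq_one_of_even c hc2 he, one_mul] at hk
      exact absurd (hk ▸ A.pow_mem ha k) (self_notMem_cpl c hc2 hA)
    · -- `c = c·a^k`, so `a^k = 1` and `ord a ∣ k` is odd
      rw [pow_eq_self_of_odd c hc2 ho] at hk
      have hak : a ^ k = 1 := mul_left_cancel (hk.trans (mul_one c).symm)
      exact ho.of_dvd_nat (orderOf_dvd_of_pow_eq_one hak)
  · intro ho
    have h : (c * a) ^ orderOf a = c := by rw [hcomm.mul_pow, pow_orderOf_eq_one, mul_one, pow_eq_self_of_odd c hc2 ho]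
    have hmem := Subgroup.npow_mem_zpowers (c * a) (orderOf a)
    rwa [h] at hmem

include hA in
omit [Fintype G] [DecidableEq G] in
/-- **`ord (c·a) = ord a` when `ord a` is even** (`a` in the complement, `c` central). [folklore] -/
theorem orderOf_cmul_of_even (hc2 : c * c = 1) (hcen : ∀ x : G, x * c = c * x) {a : G} (ha : a ∈ A) (he : Even (orderOf a)) :
    orderOf (c * a) = orderOf a := by
  have hcomm : Commute c a := (hcen a).symm
  refine Nat.dvd_antisymm (orderOf_dvd_of_pow_eq_one ?_) (orderOf_dvd_of_pow_eq_one ?_)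
  · rw [hcomm.mul_pow, pow_orderOf_eq_one, mul_one, pow_eq_one_of_even c hc2 he]
  · -- `(c a)^k = 1` with `k = ord (c a)`: `c^k · a^k = 1`; `k` odd would put `c` in `A`
    have hk : c ^ orderOf (c * a) * a ^ orderOf (c * a) = 1 := by rw [← hcomm.mul_pow, pow_orderOf_eq_one]
    rcases Nat.even_or_odd (orderOf (c * a)) with he' | ho'
    · rwa [pow_eq_one_of_even c hc2 he', one_mul] at hk
    · rw [pow_eq_self_of_odd c hc2 ho'] at hk
      have hca : a ^ orderOf (c * a) = c := by
        have h1 : c * (c * a ^ orderOf (c * a)) = c * 1 := by rw [hk]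
        rwa [← mul_assoc, hc2, one_mul, mul_one] at h1
      exact absurd (hca ▸ A.pow_mem ha _) (self_notMem_cpl c hc2 hA)

/-! ## §2 The number of blocks over the complement -/

/-- Outside the complement every element is `c·a` with `a` in the complement: `G ∖ A = c·A`. [folklore] -/
theorem compl_cplT_eq_image (hc2 : c * c = 1) : ((cplT c A hA).1)ᶜ = (cplT c A hA).1.image (c * ·) := by
  ext x
  simp only [mem_compl, mem_cplT, mem_image]
  constructor
  · intro hx
    exact ⟨c * x, cmul_mem_cpl c hA hx, cmul_cmul c hc2 x⟩
  · rintro ⟨a, ha, rfl⟩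
    exact (hA a).mp ha

/-- **THE NUMBER OF BLOCKS OF A COMPLEMENTED GALOIS CM TYPE from the order statistics of the complement**:
`β(G, c) · |G| = Σ_{a ∈ A} (1 + [ord a even]) · 2^{(|G|/2) / ord a}` (the sum runs over `cplT = A` as a finset). [folklore] -/
theorem card_block_mul_card_of_cpl (hc2 : c * c = 1) (hcen : ∀ x : G, x * c = c * x) :
    Fintype.card (Block c) * Fintype.card G =
      ∑ a ∈ (cplT c A hA).1, (if Even (orderOf a) then 2 else 1) * 2 ^ (Fintype.card G / 2 / orderOf a) := by
  classical
  rw [card_block_mul_card c hc2 hcen, ← sum_add_sum_compl (cplT c A hA).1, compl_cplT_eq_image c hA hc2,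
    sum_image (fun x _ y _ h => mul_left_cancel h), ← sum_add_distrib]
  refine sum_congr rfl fun a ha => ?_
  have haA : a ∈ A := (mem_cplT c hA a).mp ha
  have hdiv : Fintype.card G / orderOf a / 2 = Fintype.card G / 2 / orderOf a := by
    rw [Nat.div_div_eq_div_mul, Nat.div_div_eq_div_mul, mul_comm]
  rw [if_neg (not_mem_zpowers_of_mem c hA hc2 haA), hdiv]
  by_cases he : Even (orderOf a)
  · rw [if_neg (fun h => (Nat.not_odd_iff_even.mpr he) ((mem_zpowers_cmul_iff c hA hc2 hcen haA).mp h)),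
      orderOf_cmul_of_even c hA hc2 hcen haA he, hdiv, if_pos he]
    ring
  · rw [if_pos ((mem_zpowers_cmul_iff c hA hc2 hcen haA).mpr (Nat.not_even_iff_odd.mp he)), if_neg he]
    ring

/-- **`|A|` odd**: `β(G, c) · |G| = Σ_{a ∈ A} 2^{(|G|/2) / ord a}` (no element of `A` has even order). [folklore] -/
theorem card_block_mul_card_of_cpl_odd (hc2 : c * c = 1) (hcen : ∀ x : G, x * c = c * x) (hodd : Odd (Fintype.card G / 2)) :
    Fintype.card (Block c) * Fintype.card G = ∑ a ∈ (cplT c A hA).1, 2 ^ (Fintype.card G / 2 / orderOf a) := by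
  rw [card_block_mul_card_of_cpl c hA hc2 hcen]
  refine sum_congr rfl fun a ha => ?_
  have haA : a ∈ A := (mem_cplT c hA a).mp ha
  have hdvd : orderOf a ∣ Fintype.card G / 2 := by
    rw [← natCard_cpl c hc2 hA]
    exact Subgroup.orderOf_dvd_natCard A haA
  have hno : ¬ Even (orderOf a) := fun he =>
    (Nat.not_even_iff_odd.mpr hodd) (even_iff_two_dvd.mpr ((even_iff_two_dvd.mp he).trans hdvd))
  rw [if_neg hno, one_mul]

end

end Summit.HodgeConjecture.CorCM.Census.ComplementFaces
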